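import Summits.BirchSwinnertonDyer.BirchSwinnertonDyer.Theorems.SignedLowerHalvesKobayashiLowerHalfSemistableModelForm
import Summits.BirchSwinnertonDyer.BirchSwinnertonDyer.Theorems.SignedLowerHalvesKobayashiLowerHalfSemistableCellChainThree
import HarnessLib

/-!
# Crux `KobayashiLowerHalfSemistable` (route `SignedLowerHalves`, item 2 = stmt-BirchSwinnertonDyer-19000):
# the two BINDERS of the line in MODEL FORM, and the INTEGRAL socket

HONEST FRAMING (cell `bsd-ssimc`, README §4): theorems only; nothing here is a theorem about any curve; the
crux stays OPEN; BSD is not proved by any of this. Continuation of `…Theorems.ModelForm` (p607625,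
`SignedLowerHalvesKobayashiLowerHalfSemistableModelForm.lean`), which proved that the typed predicates
`KobayashiLowerDivisibility W p ε` / `KobayashiMainConjecture W p ε` follow from ONE model.

The line `Cruxes/KobayashiLowerHalfSemistable/Lines/birth.lean` closes the crux BY NAME modulo two binders
(closer of record `…Theorems.KobayashiLowerHalfSemistable_of_tiersS_C3`, p563654):
`BurungaleSkinnerTianWan2024_thm13_scopedS_OPEN` (`p ≥ 5`, conclusion `KobayashiMainConjecture`) and
`BSTW2024_lowerDivisibility_atThreeS_CELL` (`p = 3`, conclusion `KobayashiLowerDivisibility`). Both binders —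
like the printed one `BurungaleSkinnerTianWan2024_thm13_OPEN` — conclude a predicate quantified over ALL
cyclotomic data, newforms, period ratios, Pollack pairs and abstract Selmer-dual data. This file states each
binder in the shape an engine formalisation would actually deliver it:

* §1 `kobayashiLowerDivisibility_of_dvd_model` — the INTEGRAL socket: if `ϖ₀⁻¹ ∈ ℤ_p` (e.g. `ϖ₀` a
  `p`-adic unit, which is the content of the route's support binders `RealPeriodUnitPlusPeriod(Three)`,
  Manin-constant results) then a plain `Λ`-divisibility `L₀ ∣ g`, `char X₀ = (g)`, for ONE model already
  gives `KobayashiLowerDivisibility W p ε` (take `h = C(ϖ₀⁻¹)·(g/L₀)`); no identity in `ℚ_p⟦T⟧` needed;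
  `periodRatio_of_unit` / `exists_padicInt_mul_eq_one_of_norm_eq_one` feed it from a period comparison
  `Ω(W) = u·Ω⁺_f`, `‖u‖_p = 1` (the shape of the route's period-unit binders).
* §2 `thm13_scopedS_OPEN_of_models`, `lowerDivisibility_atThreeS_CELL_of_models`, `thm13_OPEN_of_models` —
  each binder ⟸ ONE model per admissible `(W, p, ε)` in its own scope (the model may use the scope witness
  `BSTWScope.HasAuxWitness W p`, i.e. the (ram) prime and the auxiliary imaginary quadratic field).
* §3 `KobayashiLowerHalfSemistable_of_binder_models` — the full chain ENGINE MODELS ⇒ BINDERS ⇒ CRUX BY NAME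
  (through p563654), still modulo modularity (`exists_isNewformOf`) and Diamond/Ribet
  (`diamond1995_refinedSerre`), which supply the scope witness (`BSTWScope_hasAuxWitness_of_goodSS`).

References: [Kobayashi2003] Conjecture (p. 2), Thm. 3.2 (p. 7); [BurungaleSkinnerTianWan2024] Thm. 1.3 /
Thm. 10.1 (PRE; shape only); [Washington1997] §13.2; [MazurTateTeitelbaum1986Invent] §I.12 (`Λ ↪ Λ ⊗ ℚ_p`).
-/

set_option autoImplicit false
set_option linter.dupNamespace false

noncomputable section

open scoped Classical MatrixGroups ModularForm

open CongruenceSubgroup WeierstrassCurve Literature.NumberTheory.EllipticCurves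
  Literature.NumberTheory.EllipticCurves.ModularForms
  Literature.NumberTheory.EllipticCurves.Rank1Residual
  Literature.NumberTheory.EllipticCurves.Kobayashi2003 ZpExtension
  Summit.BirchSwinnertonDyer.Rank1Residual.Supersingular

namespace Summit.BirchSwinnertonDyer.BirchSwinnertonDyer.Theorems.ModelForm

variable {p : ℕ} [Fact p.Prime]

/-! ### §1 The INTEGRAL socket: a plain `Λ`-divisibility `L₀ ∣ char X₀` -/

/-- **INTEGRAL MODEL FORM of the Eisenstein half.** As `kobayashiLowerDivisibility_of_model`, but the analytic
condition is a plain divisibility IN `Λ`: if the period ratio `ϖ₀` of the model has `ϖ₀⁻¹ ∈ ℤ_p` (witness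
`u ∈ ℤ_p` with `u·ϖ₀ = 1`; e.g. `ϖ₀` a `p`-adic unit — Manin constant, the route's support binders
`RealPeriodUnitPlusPeriod(Three)`), then `L₀ ∣ g` in `Λ` with `char X₀ = (g)` for ONE sign-`ε` function `L₀`
and ONE dual datum gives `KobayashiLowerDivisibility W p ε`: `g = L₀·h₁`, `ι g = ϖ₀·ι(L₀·(C u·h₁))`. This is
the divisibility a Beilinson–Flach / Euler-system argument produces. [cite: Kobayashi2003, Conjecture (Main Conjecture) (p. 2)]
[cite: MazurTateTeitelbaum1986Invent, §I.12] -/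
theorem kobayashiLowerDivisibility_of_dvd_model (W : WeierstrassCurve ℚ) [W.IsElliptic]
    [W.IsGloballyMinimal] (p : ℕ) [Fact p.Prime] (ε : ℤˣ) [NeZero (W.conductorNorm ℤ)]
    {κ₀ : ZpExtension ℚ p} {γ₀ : Field.absoluteGaloisGroup ℚ}
    (hκ₀ : κ₀.IsCyclotomic) (hγ₀ : κ₀.IsTopGenerator γ₀) (hv₀ : IsCyclotomicVariable p γ₀)
    {f₀ : CuspForm (Gamma0 (W.conductorNorm ℤ)) 2} (hf₀ : IsNewformOf W f₀)
    {ϖ₀ : ℚ} (hϖ₀ : (ϖ₀ : ℝ) * W.realPeriodRat = plusPeriod f₀)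
    (hϖint : ∃ u : ℤ_[p], (u : ℚ_[p]) * (ϖ₀ : ℚ_[p]) = 1)
    {L₀ : IwasawaAlgebra p} (hL₀ : IsSignedPAdicLFunction f₀ p ε L₀)
    (D₀ : SignedSelmerDualData W κ₀ γ₀ ε) {g : IwasawaAlgebra p}
    (hg : D₀.charIdeal = Ideal.span {g}) (hdvd : L₀ ∣ g) :
    KobayashiLowerDivisibility W p ε := by
  obtain ⟨u, hu⟩ := hϖint
  obtain ⟨h₁, rfl⟩ := hdvd
  refine kobayashiLowerDivisibility_of_model W p ε hκ₀ hγ₀ hv₀ hf₀ hϖ₀ hL₀ D₀ (h := PowerSeries.C u * h₁)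
    hg ?_
  have hu' : PowerSeries.C (ϖ₀ : ℚ_[p]) * PowerSeries.C (u : ℚ_[p]) = 1 := by
    rw [← map_mul, mul_comm, hu, map_one]
  have hC : iwasawaToPowerSeries p (PowerSeries.C u) = PowerSeries.C (u : ℚ_[p]) := by
    rw [PowerSeries.map_C]
    rfl
  rw [map_mul, map_mul, map_mul, hC]
  linear_combination (-(iwasawaToPowerSeries p L₀ * iwasawaToPowerSeries p h₁)) * hu'

/-- The same with the divisibility of IDEALS `char X₀ ≤ (L₀)` (`(g) ⊆ (L₀)`, i.e. `L₀ ∣ g`), the form in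
which a characteristic-ideal bound is usually stated. [cite: Kobayashi2003, Conjecture (Main Conjecture) (p. 2)] -/
theorem kobayashiLowerDivisibility_of_charIdeal_le_model (W : WeierstrassCurve ℚ) [W.IsElliptic]
    [W.IsGloballyMinimal] (p : ℕ) [Fact p.Prime] (ε : ℤˣ) [NeZero (W.conductorNorm ℤ)]
    {κ₀ : ZpExtension ℚ p} {γ₀ : Field.absoluteGaloisGroup ℚ}
    (hκ₀ : κ₀.IsCyclotomic) (hγ₀ : κ₀.IsTopGenerator γ₀) (hv₀ : IsCyclotomicVariable p γ₀)
    {f₀ : CuspForm (Gamma0 (W.conductorNorm ℤ)) 2} (hf₀ : IsNewformOf W f₀)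
    {ϖ₀ : ℚ} (hϖ₀ : (ϖ₀ : ℝ) * W.realPeriodRat = plusPeriod f₀)
    (hϖint : ∃ u : ℤ_[p], (u : ℚ_[p]) * (ϖ₀ : ℚ_[p]) = 1)
    {L₀ : IwasawaAlgebra p} (hL₀ : IsSignedPAdicLFunction f₀ p ε L₀)
    (D₀ : SignedSelmerDualData W κ₀ γ₀ ε) {g : IwasawaAlgebra p}
    (hg : D₀.charIdeal = Ideal.span {g}) (hle : D₀.charIdeal ≤ Ideal.span {L₀}) :
    KobayashiLowerDivisibility W p ε := by
  refine kobayashiLowerDivisibility_of_dvd_model W p ε hκ₀ hγ₀ hv₀ hf₀ hϖ₀ hϖint hL₀ D₀ hg ?_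
  have hmem : g ∈ Ideal.span {L₀} := hle (hg ▸ Ideal.mem_span_singleton_self g)
  exact Ideal.mem_span_singleton.mp hmem

/-- **Supplying `ϖ₀⁻¹ ∈ ℤ_p` from a `p`-adic unit.** If `‖ϖ₀‖_p = 1` then `ϖ₀⁻¹ ∈ ℤ_p`, in the shape of the
hypothesis `hϖint` of the integral socket. [folklore] -/
theorem exists_padicInt_mul_eq_one_of_norm_eq_one {ϖ₀ : ℚ} (h : ‖(ϖ₀ : ℚ_[p])‖ = 1) :
    ∃ u : ℤ_[p], (u : ℚ_[p]) * (ϖ₀ : ℚ_[p]) = 1 := by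
  have hne : (ϖ₀ : ℚ_[p]) ≠ 0 := fun h0 ↦ by simp [h0] at h
  exact ⟨⟨(ϖ₀ : ℚ_[p])⁻¹, by rw [norm_inv, h, inv_one]⟩, inv_mul_cancel₀ hne⟩

/-- **From the period comparison of the route's support binders to the model's period data.** If
`Ω(W) = u · Ω⁺_f` with `u ∈ ℚ` a `p`-adic unit (the conclusion of `realPeriodRat_eq_unit_mul_plusPeriod` /
`…_three`: Manin constant, Mazur 1978 Cor. 4.1, Abbes–Ullmo 1996, Greenberg–Vatsal 2000 Rem. 3.4), then
`ϖ₀ := u⁻¹` is a period ratio of the model (`ϖ₀·Ω(W) = Ω⁺_f`) with `ϖ₀⁻¹ = u ∈ ℤ_p`.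
[cite: GreenbergVatsal2000, §3, Remark 3.4] -/
theorem periodRatio_of_unit {W : WeierstrassCurve ℚ} {N : ℕ} {f : CuspForm (Gamma0 N) 2} {u : ℚ}
    (hu : ‖(u : ℚ_[p])‖ = 1) (hΩ : W.realPeriodRat = u * plusPeriod f) :
    ((u⁻¹ : ℚ) : ℝ) * W.realPeriodRat = plusPeriod f ∧
      ∃ v : ℤ_[p], (v : ℚ_[p]) * ((u⁻¹ : ℚ) : ℚ_[p]) = 1 := by
  have hne : (u : ℚ_[p]) ≠ 0 := fun h0 ↦ by simp [h0] at hu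
  have hne' : u ≠ 0 := fun h0 ↦ hne (by rw [h0, Rat.cast_zero])
  refine ⟨?_, ⟨(u : ℚ_[p]), hu.le⟩, ?_⟩
  · rw [hΩ, ← mul_assoc, Rat.cast_inv, inv_mul_cancel₀ (by exact_mod_cast hne'), one_mul]
  · change (u : ℚ_[p]) * ((u⁻¹ : ℚ) : ℚ_[p]) = 1
    rw [Rat.cast_inv, mul_inv_cancel₀ hne]

/-! ### §2 The line's binders in model form -/

/-- **The `p ≥ 5` binder `BurungaleSkinnerTianWan2024_thm13_scopedS_OPEN` ⟸ ONE MODEL per admissible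
`(W, p, ε)`**: for `W` semistable, `p ≥ 5` good supersingular, a scope witness (the (ram) prime and the
auxiliary imaginary quadratic field, which the model may use) and a sign `ε`, one normalised cyclotomic
datum, the newform, one `ϖ₀`, one sign-`ε` function `L₀` and one `Λ`-torsion dual datum with `char X₀ = (g)`,
`ι g = ϖ₀·ι L₀`. This is the deliverable of a formalisation of BSTW Thm. 1.3 = Thm. 10.1 at `p ≥ 5`; the
binder stays OPEN (PRE) — nothing is discharged here. [claim: BurungaleSkinnerTianWan2024, status: under-review]
[cite: Kobayashi2003, Conjecture (Main Conjecture) (p. 2)] -/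
theorem thm13_scopedS_OPEN_of_models
    (hmodel : ∀ (W : WeierstrassCurve ℚ) [W.IsElliptic] [W.IsGloballyMinimal] (p : ℕ) [Fact p.Prime],
      5 ≤ p → Semistable W → GoodSS W p → BSTWScope.HasAuxWitness W p → ∀ (ε : ℤˣ),
      ∀ [NeZero (W.conductorNorm ℤ)],
      ∃ (κ₀ : ZpExtension ℚ p) (γ₀ : Field.absoluteGaloisGroup ℚ)
        (f₀ : CuspForm (Gamma0 (W.conductorNorm ℤ)) 2) (ϖ₀ : ℚ) (L₀ : IwasawaAlgebra p)
        (D₀ : SignedSelmerDualData W κ₀ γ₀ ε) (g : IwasawaAlgebra p),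
        κ₀.IsCyclotomic ∧ κ₀.IsTopGenerator γ₀ ∧ IsCyclotomicVariable p γ₀ ∧ IsNewformOf W f₀ ∧
        (ϖ₀ : ℝ) * W.realPeriodRat = plusPeriod f₀ ∧ IsSignedPAdicLFunction f₀ p ε L₀ ∧
        Module.IsTorsion (IwasawaAlgebra p) D₀.X ∧ D₀.charIdeal = Ideal.span {g} ∧
        iwasawaToPowerSeries p g = PowerSeries.C (ϖ₀ : ℚ_[p]) * iwasawaToPowerSeries p L₀) :
    BurungaleSkinnerTianWan2024_thm13_scopedS_OPEN := by
  intro W _ _ p _ h5 hsst hss hw ε κ γ hκ hγ hv _ f hf ϖ hϖ Lplus Lminus hL D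
  obtain ⟨κ₀, γ₀, f₀, ϖ₀, L₀, D₀, g, hκ₀, hγ₀, hv₀, hf₀, hϖ₀, hL₀, htors, hg, hgL⟩ :=
    hmodel W p h5 hsst hss hw ε
  exact kobayashiMainConjecture_of_model W p ε hκ₀ hγ₀ hv₀ hf₀ hϖ₀ hL₀ D₀ htors hg hgL κ γ hκ hγ hv f
    hf ϖ hϖ Lplus Lminus hL D

/-- **The `p = 3` CELL binder `BSTW2024_lowerDivisibility_atThreeS_CELL` ⟸ ONE MODEL per admissible
`(W, 3, ε)`**: for `W` semistable, good supersingular at `3` with `a₃ = 0`, a scope witness and a sign `ε`,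
one normalised cyclotomic datum, the newform, one `ϖ₀`, one sign-`ε` function `L₀` and one dual datum with
`char X₀ = (g)`, `ι g = ϖ₀·ι(L₀·h)` (the Eisenstein half only; no torsion clause). The binder stays a
hypothesis of record (in-cell chain, prose) — nothing is discharged here. [claim: BurungaleSkinnerTianWan2024, status: under-review]
[cite: Kobayashi2003, Conjecture (Main Conjecture) (p. 2)] -/
theorem lowerDivisibility_atThreeS_CELL_of_models
    (hmodel : ∀ (W : WeierstrassCurve ℚ) [W.IsElliptic] [W.IsGloballyMinimal] (p : ℕ) [Fact p.Prime],
      p = 3 → Semistable W → GoodSS W p → W.frobeniusTrace 3 = 0 → BSTWScope.HasAuxWitness W p →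
      ∀ (ε : ℤˣ), ∀ [NeZero (W.conductorNorm ℤ)],
      ∃ (κ₀ : ZpExtension ℚ p) (γ₀ : Field.absoluteGaloisGroup ℚ)
        (f₀ : CuspForm (Gamma0 (W.conductorNorm ℤ)) 2) (ϖ₀ : ℚ) (L₀ : IwasawaAlgebra p)
        (D₀ : SignedSelmerDualData W κ₀ γ₀ ε) (g h : IwasawaAlgebra p),
        κ₀.IsCyclotomic ∧ κ₀.IsTopGenerator γ₀ ∧ IsCyclotomicVariable p γ₀ ∧ IsNewformOf W f₀ ∧
        (ϖ₀ : ℝ) * W.realPeriodRat = plusPeriod f₀ ∧ IsSignedPAdicLFunction f₀ p ε L₀ ∧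
        D₀.charIdeal = Ideal.span {g} ∧
        iwasawaToPowerSeries p g = PowerSeries.C (ϖ₀ : ℚ_[p]) * iwasawaToPowerSeries p (L₀ * h)) :
    BSTW2024_lowerDivisibility_atThreeS_CELL := by
  intro W _ _ p _ h3 hsst hss ha3 hw ε κ γ hκ hγ hv _ f hf ϖ hϖ Lplus Lminus hL D
  obtain ⟨κ₀, γ₀, f₀, ϖ₀, L₀, D₀, g, h, hκ₀, hγ₀, hv₀, hf₀, hϖ₀, hL₀, hg, hgh⟩ :=
    hmodel W p h3 hsst hss ha3 hw ε
  exact kobayashiLowerDivisibility_of_model W p ε hκ₀ hγ₀ hv₀ hf₀ hϖ₀ hL₀ D₀ hg hgh κ γ hκ hγ hv f hf ϖ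
    hϖ Lplus Lminus hL D

/-- **The PRINTED binder `BurungaleSkinnerTianWan2024_thm13_OPEN` (BSTW Thm. 1.3, semistable clause, every odd
supersingular `p`, `a₃ = 0` if `p = 3`) ⟸ ONE MODEL per admissible `(W, p, ε)`** (no scope witness in its
hypotheses: the printed theorem supplies its own auxiliary data). The binder stays OPEN (PRE).
[claim: BurungaleSkinnerTianWan2024, status: under-review] [cite: Kobayashi2003, Conjecture (Main Conjecture) (p. 2)] -/
theorem thm13_OPEN_of_models
    (hmodel : ∀ (W : WeierstrassCurve ℚ) [W.IsElliptic] [W.IsGloballyMinimal] (p : ℕ) [Fact p.Prime],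
      p ≠ 2 → Semistable W → GoodSS W p → (p = 3 → W.frobeniusTrace 3 = 0) → ∀ (ε : ℤˣ),
      ∀ [NeZero (W.conductorNorm ℤ)],
      ∃ (κ₀ : ZpExtension ℚ p) (γ₀ : Field.absoluteGaloisGroup ℚ)
        (f₀ : CuspForm (Gamma0 (W.conductorNorm ℤ)) 2) (ϖ₀ : ℚ) (L₀ : IwasawaAlgebra p)
        (D₀ : SignedSelmerDualData W κ₀ γ₀ ε) (g : IwasawaAlgebra p),
        κ₀.IsCyclotomic ∧ κ₀.IsTopGenerator γ₀ ∧ IsCyclotomicVariable p γ₀ ∧ IsNewformOf W f₀ ∧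
        (ϖ₀ : ℝ) * W.realPeriodRat = plusPeriod f₀ ∧ IsSignedPAdicLFunction f₀ p ε L₀ ∧
        Module.IsTorsion (IwasawaAlgebra p) D₀.X ∧ D₀.charIdeal = Ideal.span {g} ∧
        iwasawaToPowerSeries p g = PowerSeries.C (ϖ₀ : ℚ_[p]) * iwasawaToPowerSeries p L₀) :
    BurungaleSkinnerTianWan2024_thm13_OPEN := by
  intro W _ _ p _ hp hsst hss h4 ε κ γ hκ hγ hv _ f hf ϖ hϖ Lplus Lminus hL D
  obtain ⟨κ₀, γ₀, f₀, ϖ₀, L₀, D₀, g, hκ₀, hγ₀, hv₀, hf₀, hϖ₀, hL₀, htors, hg, hgL⟩ :=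
    hmodel W p hp hsst hss h4 ε
  exact kobayashiMainConjecture_of_model W p ε hκ₀ hγ₀ hv₀ hf₀ hϖ₀ hL₀ D₀ htors hg hgL κ γ hκ hγ hv f
    hf ϖ hϖ Lplus Lminus hL D

/-! ### §3 ENGINE MODELS ⇒ BINDERS ⇒ CRUX BY NAME -/

/-- **The whole chain for crux 2**: one `Λ`-torsion main-conjecture model per `(W, p ≥ 5, ε)` on scope S and
one Eisenstein-half model per `(W, 3, ε)` on scope S give the two binders (§2), hence the crux BY NAME through
the closer of record `KobayashiLowerHalfSemistable_of_tiersS_C3` (p563654) — still modulo modularity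
(`exists_isNewformOf`) and Diamond 1995 / Ribet 1990 (`diamond1995_refinedSerre`), which make the scope
witness free (`BSTWScope_hasAuxWitness_of_goodSS`). CONDITIONAL composition; closes nothing.
[claim: BurungaleSkinnerTianWan2024, status: under-review] [cite: Kobayashi2003, Conjecture (Main Conjecture) (p. 2)]
[cite: Ribet1990, Thm. 1.1] -/
theorem KobayashiLowerHalfSemistable_of_binder_models
    (hmodel5 : ∀ (W : WeierstrassCurve ℚ) [W.IsElliptic] [W.IsGloballyMinimal] (p : ℕ) [Fact p.Prime],
      5 ≤ p → Semistable W → GoodSS W p → BSTWScope.HasAuxWitness W p → ∀ (ε : ℤˣ),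
      ∀ [NeZero (W.conductorNorm ℤ)],
      ∃ (κ₀ : ZpExtension ℚ p) (γ₀ : Field.absoluteGaloisGroup ℚ)
        (f₀ : CuspForm (Gamma0 (W.conductorNorm ℤ)) 2) (ϖ₀ : ℚ) (L₀ : IwasawaAlgebra p)
        (D₀ : SignedSelmerDualData W κ₀ γ₀ ε) (g : IwasawaAlgebra p),
        κ₀.IsCyclotomic ∧ κ₀.IsTopGenerator γ₀ ∧ IsCyclotomicVariable p γ₀ ∧ IsNewformOf W f₀ ∧
        (ϖ₀ : ℝ) * W.realPeriodRat = plusPeriod f₀ ∧ IsSignedPAdicLFunction f₀ p ε L₀ ∧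
        Module.IsTorsion (IwasawaAlgebra p) D₀.X ∧ D₀.charIdeal = Ideal.span {g} ∧
        iwasawaToPowerSeries p g = PowerSeries.C (ϖ₀ : ℚ_[p]) * iwasawaToPowerSeries p L₀)
    (hmodel3 : ∀ (W : WeierstrassCurve ℚ) [W.IsElliptic] [W.IsGloballyMinimal] (p : ℕ) [Fact p.Prime],
      p = 3 → Semistable W → GoodSS W p → W.frobeniusTrace 3 = 0 → BSTWScope.HasAuxWitness W p →
      ∀ (ε : ℤˣ), ∀ [NeZero (W.conductorNorm ℤ)],
      ∃ (κ₀ : ZpExtension ℚ p) (γ₀ : Field.absoluteGaloisGroup ℚ)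
        (f₀ : CuspForm (Gamma0 (W.conductorNorm ℤ)) 2) (ϖ₀ : ℚ) (L₀ : IwasawaAlgebra p)
        (D₀ : SignedSelmerDualData W κ₀ γ₀ ε) (g h : IwasawaAlgebra p),
        κ₀.IsCyclotomic ∧ κ₀.IsTopGenerator γ₀ ∧ IsCyclotomicVariable p γ₀ ∧ IsNewformOf W f₀ ∧
        (ϖ₀ : ℝ) * W.realPeriodRat = plusPeriod f₀ ∧ IsSignedPAdicLFunction f₀ p ε L₀ ∧
        D₀.charIdeal = Ideal.span {g} ∧
        iwasawaToPowerSeries p g = PowerSeries.C (ϖ₀ : ℚ_[p]) * iwasawaToPowerSeries p (L₀ * h))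
    (hmod : exists_isNewformOf) (hLL : Literature.NumberTheory.Automorphic.diamond1995_refinedSerre) :
    Summit.BirchSwinnertonDyer.BirchSwinnertonDyer.Theses.SignedLowerHalves.KobayashiLowerHalfSemistable :=
  KobayashiLowerHalfSemistable_of_tiersS_C3 (thm13_scopedS_OPEN_of_models hmodel5)
    (lowerDivisibility_atThreeS_CELL_of_models hmodel3) hmod hLL

end Summit.BirchSwinnertonDyer.BirchSwinnertonDyer.Theorems.ModelForm

end
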